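import Mathlib
import Literature.Geometry.Lorentzian.ChartwiseAnalyticity
import Literature.Geometry.Lorentzian.CausalityOpennessProofs
import Literature.Geometry.Lorentzian.NomizuKillingExtensionChart
import Literature.Geometry.Manifold.SimplyConnectedSublevelNhds
import HarnessLib

/-!
# Local extendability of `T`-commuting Killing fields in the chartwise-analytic region of a
stationary black hole (local Nomizu, in the form consumed by coherent continuation)

Assuming Nomizu's extension theorem (`PseudoRiemannianMetric.Nomizu1960_killing_extension`,
Nomizu 1960, Thms. 1–2 / Chruściel 1997, Thm. 2.1), every point `x` of an open set `A` of a
stationary black hole space-time at whose points the metric is real-analytic in some chart of the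
maximal `C^∞` atlas (`StationaryAFBlackHole.IsChartwiseAnalyticAt`, the conclusion shape of
Müller zum Hagen 1970) has a connected open neighbourhood `S ⊆ A` with the LOCAL EXTENSION
PROPERTY: every `y ∈ S` has arbitrarily small open neighbourhoods `B ⊆ S` such that every Killing
field on `B` commuting with the stationary field `T` extends to a Killing field on `S` commuting
with `T`.  This is exactly hypothesis `hloc` of the coherent continuation theorem
`PseudoRiemannianMetric.IsKillingFieldOn.exists_extension_of_coherent`
(`KillingCoherentContinuation.lean`).  Construction: `S := ψ⁻¹(ball)` for an analytic chart `ψ` at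
`x` and a coordinate ball inside `ψ(A ∩ ψ.source)`; `B := ψ⁻¹(small ball)`; the extension is the
tree's local Nomizu in the restricted chart `ψ|_S` (simply connected convex target, connected
`ψ(B)`), `MaxAtlasChart.exists_killingOn_source_mlieBracket_zero_eqOn`
(`NomizuKillingExtensionChart.lean`), the pattern of the landed stub
`stub_pointContinuationAnalytic` of the crux `NonTrappingHawkingRigidity`.

Everything here is proved (modulo the explicit hypothesis `Nomizu1960_killing_extension`); no
definitions, no named facts.

## References
* K. Nomizu, Ann. of Math. 72 (1960) 105–120, Thms. 1–2. [Nomizu1960]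
* P. T. Chruściel, Comm. Math. Phys. 189 (1997) 1–7, Thm. 2.1. [Chrusciel1997]
* J. M. Lee, *Introduction to Smooth Manifolds*, 2nd ed. (2013), Prop. 1.16 ff. (coordinate balls). [LeeSmoothManifolds2013]
-/

noncomputable section

open Set Filter Function Bundle TopologicalSpace VectorField Metric
  Literature.Geometry.Manifold
open scoped Manifold ContDiff Topology

namespace Literature.Geometry.Lorentzian

namespace StationaryAFBlackHole

variable (𝓑 : StationaryAFBlackHole.{0}) [𝓑.metric.HasLeviCivita]

/-- A coordinate ball of a chart, pulled back: for `ψ` an open partial homeomorphism, `c` a point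
of an open `O ⊆ ψ.target`, there is `r > 0` with `ball c r ⊆ O`, and then
`S := ψ.source ∩ ψ⁻¹(ball c r) = ψ⁻¹'' (ball c r)` is open, connected and simply connected, with
`ψ '' S = ball c r`. Lee 2013, Prop. 1.16 ff. (coordinate balls). [cite: LeeSmoothManifolds2013, Prop. 1.16] -/
theorem exists_coordBall {X : Type*} [TopologicalSpace X] {F : Type*} [NormedAddCommGroup F]
    [NormedSpace ℝ F] (ψ : OpenPartialHomeomorph X F) {O : Set F} (hO : IsOpen O)
    (hOt : O ⊆ ψ.target) {c : F} (hc : c ∈ O) :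
    ∃ r > (0 : ℝ), ball c r ⊆ O ∧ IsOpen (ψ.source ∩ ψ ⁻¹' ball c r) ∧
      ψ.source ∩ ψ ⁻¹' ball c r = ψ.symm '' ball c r ∧
      IsConnected (ψ.source ∩ ψ ⁻¹' ball c r) ∧ IsSimplyConnected (ψ.source ∩ ψ ⁻¹' ball c r) ∧
      ψ '' (ψ.source ∩ ψ ⁻¹' ball c r) = ball c r := by
  obtain ⟨r, hr, hball⟩ := Metric.isOpen_iff.1 hO c hc
  have hbt : ball c r ⊆ ψ.target := hball.trans hOt
  have hbs : ball c r ⊆ ψ.symm.source := by rw [ψ.symm_source]; exact hbt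
  have heq : ψ.source ∩ ψ ⁻¹' ball c r = ψ.symm '' ball c r :=
    (ψ.symm_image_eq_source_inter_preimage hbt).symm
  have hconv : Convex ℝ (ball c r) := convex_ball c r
  have hne : (ball c r).Nonempty := ⟨c, mem_ball_self hr⟩
  refine ⟨r, hr, hball, ψ.isOpen_inter_preimage isOpen_ball, heq, ?_, ?_, ?_⟩
  · rw [heq]
    exact isConnected_image_of_subset_source ψ.symm hbs ⟨hne, hconv.isPreconnected⟩
  · rw [heq]
    exact (isSimplyConnected_image_iff_of_subset_source ψ.symm hbs).2
      (isSimplyConnected_of_convex hconv hne)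
  · rw [heq]
    exact ψ.image_symm_image_of_subset_target hbt

/-- **Local extendability of `T`-commuting Killing fields in the chartwise-analytic region** (local
Nomizu, packaged as hypothesis `hloc` of `IsKillingFieldOn.exists_extension_of_coherent`).  Assume
Nomizu's extension theorem.  Let `A` be an open set of the stationary black hole `𝓑` at every point
of which the metric is chartwise analytic.  Then every `x ∈ A` has an open connected neighbourhood
`S ⊆ A` such that for every `y ∈ S` and every neighbourhood `N` of `y` there is an open `B` with
`y ∈ B ⊆ N ∩ S` such that every Killing field `L` of `g` on `B` with `[T, L] = 0` on `B` extends to a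
Killing field `L'` on `S` with `[T, L'] = 0` on `S` and `L' = L` on `B` (`T = 𝓑.killing`).  Proof in
the module docstring. Nomizu 1960, Thms. 1–2; Chruściel 1997, Thm. 2.1.
[cite: Chrusciel1997, Thm. 2.1] -/
theorem localKillingExtension_of_isChartwiseAnalyticAt
    (hN : PseudoRiemannianMetric.Nomizu1960_killing_extension) {A : Set 𝓑.carrier}
    (hA : IsOpen A) (han : ∀ x ∈ A, 𝓑.IsChartwiseAnalyticAt x) :
    ∀ x ∈ A, ∃ S : Set 𝓑.carrier, IsOpen S ∧ x ∈ S ∧ S ⊆ A ∧ IsConnected S ∧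
      ∀ y ∈ S, ∀ N ∈ 𝓝 y, ∃ B : Set 𝓑.carrier, IsOpen B ∧ y ∈ B ∧ B ⊆ N ∩ S ∧
        ∀ L : Π z : 𝓑.carrier, TangentSpace (𝓡 4) z,
          𝓑.metric.toPseudoRiemannianMetric.IsKillingFieldOn L B →
          (∀ z ∈ B, mlieBracket (𝓡 4) 𝓑.killing L z = 0) →
          ∃ L' : Π z : 𝓑.carrier, TangentSpace (𝓡 4) z,
            𝓑.metric.toPseudoRiemannianMetric.IsKillingFieldOn L' S ∧
            (∀ z ∈ S, mlieBracket (𝓡 4) 𝓑.killing L' z = 0) ∧ ∀ z ∈ B, L' z = L z := by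
  intro x hx
  set g := 𝓑.metric.toPseudoRiemannianMetric with hg
  have hT : g.IsKillingField 𝓑.killing := 𝓑.isStationaryKilling.isKillingField
  obtain ⟨ψ, hψ, hxψ, hAn⟩ := han x hx
  -- a coordinate ball around `ψ x` inside `ψ (A ∩ ψ.source)`
  set O : Set E4 := ψ.target ∩ ψ.symm ⁻¹' A with hO
  have hOo : IsOpen O := ψ.isOpen_inter_preimage_symm hA
  have hxO : ψ x ∈ O := by
    refine ⟨ψ.map_source hxψ, ?_⟩
    show ψ.symm (ψ x) ∈ A
    rw [ψ.left_inv hxψ]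
    exact hx
  obtain ⟨r, hr, hball, hSo, hSeq, hSc, hSsc, hSim⟩ := exists_coordBall ψ hOo inter_subset_left hxO
  set S : Set 𝓑.carrier := ψ.source ∩ ψ ⁻¹' ball (ψ x) r with hS
  have hxS : x ∈ S := ⟨hxψ, mem_ball_self hr⟩
  have hSψ : S ⊆ ψ.source := inter_subset_left
  have hSA : S ⊆ A := by
    rintro z ⟨hzs, hzb⟩
    have h := (hball hzb).2
    show z ∈ A
    have h' : ψ.symm (ψ z) ∈ A := h
    rwa [ψ.left_inv hzs] at h'
  -- the restricted chart `ψ|_S`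
  set ψS := ψ.restr S with hψS_def
  have hψS : ψS ∈ IsManifold.maximalAtlas (𝓡 4) ∞ 𝓑.carrier := restr_mem_maximalAtlas _ hψ hSo
  have hsrc : ψS.source = S := by
    rw [hψS_def, ψ.restr_source' S hSo, inter_eq_right.2 hSψ]
  have htgt : ψS.target ⊆ ψ.target := by
    rw [hψS_def, restr_target_eq_image ψ hSo hSψ]
    exact (image_mono hSψ).trans ψ.image_source_eq_target.le
  have hA' : ∀ a b : E4, AnalyticOnNhd ℝ
      (fun p : E4 ↦ g.val (ψS.symm p) (mfderiv 𝓘(ℝ, E4) (𝓡 4) ψS.symm p a)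
        (mfderiv 𝓘(ℝ, E4) (𝓡 4) ψS.symm p b)) ψS.target := fun a b ↦
    (hAn a b).mono htgt
  have hsc : IsSimplyConnected ψS.target := isSimplyConnected_restr_target ψ hSo hSψ hSsc
  refine ⟨S, hSo, hxS, hSA, hSc, fun y hyS N hNy ↦ ?_⟩
  -- a small coordinate ball around `ψ y` inside `ψ (interior N ∩ S)`
  set O' : Set E4 := ψ.target ∩ ψ.symm ⁻¹' (interior N ∩ S) with hO'
  have hO'o : IsOpen O' := ψ.isOpen_inter_preimage_symm (isOpen_interior.inter hSo)
  have hyO' : ψ y ∈ O' := by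
    refine ⟨ψ.map_source (hSψ hyS), ?_⟩
    show ψ.symm (ψ y) ∈ interior N ∩ S
    rw [ψ.left_inv (hSψ hyS)]
    exact ⟨mem_interior_iff_mem_nhds.2 hNy, hyS⟩
  obtain ⟨r', hr', hball', hBo, hBeq, hBc, -, hBim⟩ :=
    exists_coordBall ψ hO'o inter_subset_left hyO'
  set B : Set 𝓑.carrier := ψ.source ∩ ψ ⁻¹' ball (ψ y) r' with hB
  have hyB : y ∈ B := ⟨hSψ hyS, mem_ball_self hr'⟩
  have hBNS : B ⊆ N ∩ S := by
    rintro z ⟨hzs, hzb⟩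
    have h : ψ.symm (ψ z) ∈ interior N ∩ S := (hball' hzb).2
    rw [ψ.left_inv hzs] at h
    exact ⟨interior_subset h.1, h.2⟩
  have hBS : B ⊆ S := fun z hz ↦ (hBNS hz).2
  refine ⟨B, hBo, hyB, hBNS, fun L hL hTL ↦ ?_⟩
  -- local Nomizu in `ψ|_S`
  have hDc : IsConnected (ψS '' (ψS.source ∩ B)) := by
    rw [hψS_def, image_restr_source_inter ψ hSo hSψ B, inter_eq_right.2 hBS]
    exact isConnected_image_of_subset_source ψ (hBS.trans hSψ) hBc
  obtain ⟨L', hL'K, hTL', hL'eq⟩ :=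
    MaxAtlasChart.exists_killingOn_source_mlieBracket_zero_eqOn hN g hψS hA' hsc hBo hDc hL hT hTL
  rw [hsrc] at hL'K hTL' hL'eq
  exact ⟨L', hL'K, hTL', fun z hz ↦ hL'eq z ⟨hBS hz, hz⟩⟩

end StationaryAFBlackHole

end Literature.Geometry.Lorentzian

end
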